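import Summits.ResolutionOfSingularities.ResolutionOfSingularities.Theorems.NearCutPort
import Literature.AlgebraicGeometry.Resolution.NearChainTerminationETwo
import HarnessLib

/-!
# NearCutPortBridge — decomp-res node «NearCut» (lens-3), the kernel bridge from the printed fact to the port

The node's ONE port `NearCut.NearChainPort` (`Theorems/NearCutPort.lean`: no infinite chain of `K`-rational near
points of multiplicity `s ≥ 2` with `s`-fold-plane tangent cones and isolated multiplicity-`s` locus, read in the
charts of the point blow-ups of `𝔸³_K`) is, with its two support definitions `multIdeal` / `IsolatedMult` unfolded,
LITERALLY the Literature NAMED FACT `Literature.AlgebraicGeometry.Resolution.CJS2020_nearChainStops_eTwo`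
(`Literature/AlgebraicGeometry/Resolution/NearChainTerminationETwo.lean`: Cossart–Jannsen–Saito, LNM 2270 (2020),
Thm. 6.40 p. 104 with Def. 6.38/6.39 pp. 103–104, boundary `𝓑 = ∅` — = arXiv:0905.2191v2 Thm. 5.40 / Def. 5.38–5.39).
This file records the bridge in kernel (both directions are `η`-expansion: the two propositions are definitionally
equal) and the consumer: the balanced-tail class `NoBalancedTailsDeep` follows from the PRINTED FACT plus the node's
two dictionary pieces (`noBalancedTails_of_pieces`).  Critic row 174 (2) (decomp-res CRITIC-LEDGER): the MAP +1 of
the node stands on the port being filed as a Literature item typed weaker-than-printed with this bridge.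
Landing target: `Summits/ResolutionOfSingularities/ResolutionOfSingularities/Theorems/NearCutPortBridge.lean`
(`--kind proof --supports stmt-ResolutionOfSingularities-31770`).
-/

namespace Summit.ResolutionOfSingularities.ResolutionOfSingularities.Theorems.NearCut

open Literature.AlgebraicGeometry.Resolution

/-- **The port from the printed fact**: CJS 2020 Thm. 6.40 (as the Literature named fact
`CJS2020_nearChainStops_eTwo`) gives `NearChainPort` — the two are the same proposition once `IsolatedMult` /
`multIdeal` are unfolded. (Sources: CossartJannsenSaito2020, Thm. 6.40, Def. 6.38, Def. 6.39.) -/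
theorem nearChainPort_of_CJS2020 (h : CJS2020_nearChainStops_eTwo) : NearChainPort :=
  fun K _ s hs G j b hb hG ho hd hi => h K s hs G j b hb hG ho hd hi

/-- **The port IS the printed fact** (typed weaker-than-printed): `NearChainPort ↔ CJS2020_nearChainStops_eTwo`,
both directions by `η`-expansion. (Sources: CossartJannsenSaito2020, Thm. 6.40.) -/
theorem nearChainPort_iff_CJS2020 : NearChainPort ↔ CJS2020_nearChainStops_eTwo :=
  ⟨fun h K _ s hs G j b hb hG ho hd hi => h K s hs G j b hb hG ho hd hi, nearChainPort_of_CJS2020⟩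

/-- **Consumer**: the balanced-tail class from the PRINTED FACT and the node's two dictionary pieces
(`CompanionLaw`, `SheddingLemma`) — `noBalancedTails_of_pieces` with the port supplied by CJS 2020 Thm. 6.40.
(Sources: CossartJannsenSaito2020, Thm. 6.40.) -/
theorem noBalancedTails_of_CJS2020_pieces (h : CJS2020_nearChainStops_eTwo) (hC : CompanionLaw)
    (hS : SheddingLemma) : NoBalancedTailsDeep :=
  noBalancedTails_of_pieces (nearChainPort_of_CJS2020 h) hC hS

end Summit.ResolutionOfSingularities.ResolutionOfSingularities.Theorems.NearCut
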